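import Summits.CriticalPhenomena.PercolationContinuityZ3.Theorems.PercNearOneGluingNoHeavyQuantIndepBlobHeavyLine
import Summits.CriticalPhenomena.PercolationContinuityZ3.Theorems.PercNearOneGluingNoHeavyQuantIndepBlobCloudTopCell
import HarnessLib

/-!
# QUANT lane R8, T-DIB: Case B of Conjecture J′ from the chord cells of the light cloud (the top cell discharged)

builds on p205010 (kernel theorem, internal audit signed; external expert review pending)

Support file (`--supports stmt-CriticalPhenomena-4575`), QUANT lane seat prim-quant-p1 (gen 12); memo
`run/shared/lean/prim/quant/P1-SURPLUS.md` §23.10–23.11.  Theorems only; no definitions, no sorries, standard axioms.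

`Quant.IndepBlob.caseB_of_cloudChords`: for a Case-B system (floor `1/2 < x < 1`, gates in `[0,1]`, lights `p < x` (properness is not
needed here), heavy total `A ≤ 2j`, no light heavy-mergeable, DIB\* credit) the row `x ≤ P(N ≥ j+1)` follows from the chord inequalities
of the LIGHT CLOUD `S = {p < x}` (`tail_ge_of_heavyChords`) in the cells BELOW the top: the hypotheses are the hint case
(`x ≤ TL_S(j+1−m)` when the heavy mean `m ≤ j` is an integer) and the chords `(n₁, n₂)` with `j + 1 − n₁ ≤ Σ_S a`; the top cell
(`j + 1 − n₁ > Σ_S a`, where `TL_S = 0` at the lower level and `= 1` at the upper one) is discharged here by `cloud_topCell`, whose two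
credit bounds `K ≤ x·Σ_S a` and `(1−x)K·A ≤ (Σ_S a)(j − x²A)` are read off the cloud (the second is per-light non-mergeability).  Combined
with `corner_of_caseB` this leaves, for DIB\* on the whole corner, exactly the sub-top chord inequalities of proper non-mergeable clouds —
(B″)/(B‴) of the memo.  [cite: KozmaNitzan2024, Conjecture 3 (p. 15)] (the gluing rows served); [this work].
-/

namespace Summit.CriticalPhenomena.PercolationContinuityZ3.Theorems

namespace Quant

namespace IndepBlob

open Finset

/-- **Case B from the sub-top chord cells of the light cloud.**  See the module docstring. [this work] -/
theorem caseB_of_cloudChords {κ : Type*} [Fintype κ] [DecidableEq κ] (p : κ → ℝ) (a : κ → ℕ) (x : ℝ) (j : ℕ)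
    (hx : 1 / 2 < x) (hx1 : x < 1) (hp0 : ∀ k, 0 ≤ p k) (hp1 : ∀ k, p k ≤ 1)
    (hA : ∑ k ∈ ((Finset.univ : Finset κ).filter (fun k => p k < x))ᶜ, a k ≤ 2 * j)
    (hnm : ∀ k, p k < x → p k * ((∑ i ∈ ((Finset.univ : Finset κ).filter (fun k => p k < x))ᶜ, a i : ℕ) : ℝ) < j)
    (hcredit : (2 * j : ℝ) < ∑ k, (a k : ℝ) * (if x ≤ p k then p k else (p k - x ^ 2) / (1 - x)))
    (hhint : ∀ n : ℕ, n ≤ j → n ≤ ∑ k ∈ ((Finset.univ : Finset κ).filter (fun k => p k < x))ᶜ, a k →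
      (n : ℝ) = ∑ k ∈ ((Finset.univ : Finset κ).filter (fun k => p k < x))ᶜ, (a k : ℝ) * p k →
      x ≤ ∑ s ∈ ((Finset.univ : Finset κ).filter (fun k => p k < x)).powerset,
        (∏ i ∈ (Finset.univ : Finset κ).filter (fun k => p k < x), (if i ∈ s then p i else 1 - p i)) *
          (if j + 1 - n ≤ ∑ i ∈ s, a i then (1 : ℝ) else 0))
    (hcells : ∀ n₁ n₂ : ℕ, (n₁ : ℝ) < ∑ k ∈ ((Finset.univ : Finset κ).filter (fun k => p k < x))ᶜ, (a k : ℝ) * p k →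
      (∑ k ∈ ((Finset.univ : Finset κ).filter (fun k => p k < x))ᶜ, (a k : ℝ) * p k) < (n₂ : ℝ) →
      n₂ ≤ ∑ k ∈ ((Finset.univ : Finset κ).filter (fun k => p k < x))ᶜ, a k →
      j + 1 - n₁ ≤ ∑ i ∈ (Finset.univ : Finset κ).filter (fun k => p k < x), a i →
      x * ((n₂ : ℝ) - n₁) ≤
        ((n₂ : ℝ) - ∑ k ∈ ((Finset.univ : Finset κ).filter (fun k => p k < x))ᶜ, (a k : ℝ) * p k) *
            (∑ s ∈ ((Finset.univ : Finset κ).filter (fun k => p k < x)).powerset,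
              (∏ i ∈ (Finset.univ : Finset κ).filter (fun k => p k < x), (if i ∈ s then p i else 1 - p i)) *
                (if j + 1 - n₁ ≤ ∑ i ∈ s, a i then (1 : ℝ) else 0)) +
          ((∑ k ∈ ((Finset.univ : Finset κ).filter (fun k => p k < x))ᶜ, (a k : ℝ) * p k) - n₁) *
            (∑ s ∈ ((Finset.univ : Finset κ).filter (fun k => p k < x)).powerset,
              (∏ i ∈ (Finset.univ : Finset κ).filter (fun k => p k < x), (if i ∈ s then p i else 1 - p i)) *
                (if j + 1 - n₂ ≤ ∑ i ∈ s, a i then (1 : ℝ) else 0))) :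
    x ≤ ∑ s ∈ (Finset.univ : Finset (Finset κ)).filter (fun s => j + 1 ≤ ∑ k ∈ s, a k),
      (∏ k, if k ∈ s then p k else 1 - p k) := by
  set S : Finset κ := (Finset.univ : Finset κ).filter (fun k => p k < x) with hS
  set A : ℕ := ∑ k ∈ Sᶜ, a k with hAdef
  set m : ℝ := ∑ k ∈ Sᶜ, (a k : ℝ) * p k with hmdef
  set Bt : ℕ := ∑ i ∈ S, a i with hBt
  have hBtR : (Bt : ℝ) = ∑ i ∈ S, (a i : ℝ) := by rw [hBt, Nat.cast_sum]
  have hε : 0 < 1 - x := by linarith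
  have hmemS : ∀ k, k ∈ S ↔ p k < x := fun k => by rw [hS, Finset.mem_filter]; simp
  have hmemSc : ∀ k, k ∈ Sᶜ ↔ x ≤ p k := fun k => by rw [Finset.mem_compl, hmemS, not_lt]
  -- the level function of the cloud: `0` above the total light mass, `1` at level `0`
  have hTLtop : ∀ t : ℕ, Bt < t →
      ∑ s ∈ S.powerset, (∏ i ∈ S, (if i ∈ s then p i else 1 - p i)) * (if t ≤ ∑ i ∈ s, a i then (1 : ℝ) else 0) = 0 := by
    intro t ht
    refine Finset.sum_eq_zero fun s hs => ?_
    have hsub : s ⊆ S := Finset.mem_powerset.1 hs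
    have hle : ∑ i ∈ s, a i ≤ Bt := Finset.sum_le_sum_of_subset hsub
    rw [if_neg (by omega), mul_zero]
  have hTL0 : ∑ s ∈ S.powerset, (∏ i ∈ S, (if i ∈ s then p i else 1 - p i)) * (if 0 ≤ ∑ i ∈ s, a i then (1 : ℝ) else 0) = 1 := by
    have e : ∀ s ∈ S.powerset, (∏ i ∈ S, (if i ∈ s then p i else 1 - p i)) * (if 0 ≤ ∑ i ∈ s, a i then (1 : ℝ) else 0) =
        ∏ i ∈ S, (if i ∈ s then p i else 1 - p i) := fun s _ => by rw [if_pos (Nat.zero_le _), mul_one]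
    rw [Finset.sum_congr rfl e, sum_powerset_weight]
  -- heavy side
  have hxA : x * (A : ℝ) ≤ m := by
    rw [hAdef, hmdef, Nat.cast_sum, Finset.mul_sum]
    refine Finset.sum_le_sum fun k hk => ?_
    have h1 := (hmemSc k).1 hk
    have h2 : (0 : ℝ) ≤ (a k : ℝ) := Nat.cast_nonneg _
    have := mul_le_mul_of_nonneg_left h1 h2
    linarith
  have hmA' : m ≤ (A : ℝ) := by
    rw [hAdef, hmdef, Nat.cast_sum]
    refine Finset.sum_le_sum fun k _ => ?_
    have h2 : (0 : ℝ) ≤ (a k : ℝ) := Nat.cast_nonneg _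
    have := mul_le_mul_of_nonneg_left (hp1 k) h2
    linarith
  have hA2 : (A : ℝ) ≤ 2 * j := by exact_mod_cast hA
  -- light credit `K = Σ_S a κ(p)` and the split of the DIB* credit
  set K : ℝ := ∑ k ∈ S, (a k : ℝ) * ((p k - x ^ 2) / (1 - x)) with hK
  have hsplit : ∑ k, (a k : ℝ) * (if x ≤ p k then p k else (p k - x ^ 2) / (1 - x)) = m + K := by
    rw [← Finset.sum_compl_add_sum S, hmdef, hK]
    congr 1
    · refine Finset.sum_congr rfl fun k hk => ?_
      rw [if_pos ((hmemSc k).1 hk)]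
    · refine Finset.sum_congr rfl fun k hk => ?_
      rw [if_neg (not_le.2 ((hmemS k).1 hk))]
  have hcr : (2 * j : ℝ) < m + K := by rw [← hsplit]; exact hcredit
  -- the two bounds on `K`
  have hKx : K ≤ x * (Bt : ℝ) := by
    rw [hK, hBtR, Finset.mul_sum]
    refine Finset.sum_le_sum fun k hk => ?_
    have hkx := (hmemS k).1 hk
    have hκ : (p k - x ^ 2) / (1 - x) ≤ x := by
      rw [div_le_iff₀ hε]; nlinarith
    have := mul_le_mul_of_nonneg_left hκ (Nat.cast_nonneg (a k))
    linarith
  have hKA : (1 - x) * K * (A : ℝ) ≤ (Bt : ℝ) * (j - x ^ 2 * (A : ℝ)) := by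
    have hterm : ∀ k ∈ S, (1 - x) * ((a k : ℝ) * ((p k - x ^ 2) / (1 - x))) * (A : ℝ) ≤ (a k : ℝ) * (j - x ^ 2 * (A : ℝ)) := by
      intro k hk
      have hkx := (hmemS k).1 hk
      have hnmk := hnm k hkx
      have e : (1 - x) * ((a k : ℝ) * ((p k - x ^ 2) / (1 - x))) * (A : ℝ) = (a k : ℝ) * ((p k - x ^ 2) * (A : ℝ)) := by
        field_simp
      rw [e]
      refine mul_le_mul_of_nonneg_left ?_ (Nat.cast_nonneg _)
      nlinarith
    calc (1 - x) * K * (A : ℝ) = ∑ k ∈ S, (1 - x) * ((a k : ℝ) * ((p k - x ^ 2) / (1 - x))) * (A : ℝ) := by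
          rw [hK, Finset.mul_sum, Finset.sum_mul]
      _ ≤ ∑ k ∈ S, (a k : ℝ) * (j - x ^ 2 * (A : ℝ)) := Finset.sum_le_sum hterm
      _ = (Bt : ℝ) * (j - x ^ 2 * (A : ℝ)) := by rw [← Finset.sum_mul, hBtR]
  -- conclusion via the chord certificate with `S` = the light cloud
  rw [Finset.sum_filter]
  have hconv : ∑ s : Finset κ, (if j + 1 ≤ ∑ k ∈ s, a k then (∏ k, if k ∈ s then p k else 1 - p k) else 0) =
      ∑ s : Finset κ, (∏ i, (if i ∈ s then p i else 1 - p i)) * (if j + 1 ≤ ∑ i ∈ s, a i then (1 : ℝ) else 0) := by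
    refine Finset.sum_congr rfl fun s _ => ?_
    split_ifs <;> simp
  rw [hconv]
  refine tail_ge_of_heavyChords p a hp0 hp1 S j x (fun n hn hnm' => ?_) (fun n₁ n₂ h1 h2 h3 => ?_)
  · -- hint case
    by_cases hnj : n ≤ j
    · exact hhint n hnj hn hnm'
    · have h0 : j + 1 - n = 0 := by omega
      rw [h0, hTL0]
      exact hx1.le
  · by_cases htop : j + 1 - n₁ ≤ Bt
    · exact hcells n₁ n₂ h1 h2 h3 htop
    · -- the top cell
      have hBt' : Bt < j + 1 - n₁ := not_le.mp htop
      rw [hTLtop (j + 1 - n₁) hBt']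
      -- `n₂ ≥ j + 1`: otherwise `K > 2j − m > j ≥ Bt ≥ K/x`, absurd
      have hn2A : (n₂ : ℝ) ≤ A := by exact_mod_cast h3
      have hn2 : j + 1 ≤ n₂ := by
        by_contra hlt
        have hn2j : (n₂ : ℝ) ≤ j := by exact_mod_cast (show n₂ ≤ j by omega)
        have hBtj : (Bt : ℝ) ≤ j := by exact_mod_cast (show Bt ≤ j by omega)
        have hx0 : 0 < x := by linarith
        -- `K > j` but `K ≤ x Bt ≤ x j < j`
        have : (j : ℝ) < K := by linarith
        nlinarith
      have h0 : j + 1 - n₂ = 0 := by omega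
      rw [h0, hTL0]
      -- `cloud_topCell`
      have hn1j : n₁ ≤ j := by
        by_contra h
        have : j + 1 - n₁ = 0 := by omega
        omega
      have hBtle : (Bt : ℝ) ≤ (j : ℝ) - (n₁ : ℝ) := by
        have : Bt + n₁ ≤ j := by omega
        have h' : ((Bt + n₁ : ℕ) : ℝ) ≤ j := by exact_mod_cast this
        push_cast at h'
        linarith
      have hj1 : (1 : ℝ) ≤ j := by
        have : 1 ≤ j := by omega
        exact_mod_cast this
      have htop' := cloud_topCell x j n₁ A m K Bt hx hx1 hj1 (Nat.cast_nonneg _) hxA hmA' hA2 (Nat.cast_nonneg _) hBtle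
        hKx hKA hcr
      have hd : (0 : ℝ) ≤ (A : ℝ) - n₂ := by linarith
      nlinarith [htop', hd]

end IndepBlob

end Quant

end Summit.CriticalPhenomena.PercolationContinuityZ3.Theorems
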